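import Mathlib
import HarnessLib
import Literature.Analysis.FluidPDE.LocalPressureLiouville
import Summits.NavierStokesRegularity.NavierStokesRegularity.Theorems.PoloidalWindowDoorPoloidalWindowRigidityPressureGaugeTools
/-!
# Route `PoloidalWindowDoor`, crux `PoloidalWindowRigidity` (K2, stmt-NavierStokesRegularity-19708) —
# THE PRESSURE GAUGE OF A SLICE: the mollified pressure-gradient functional of a bounded pair is CONSTANT

Cell ns-regularity-ideate, seat nsreg-p7 (gen 6, third worker under the K2 lead; `--supports stmt-…-19708`).
First brick of the discharge of the K2 lead's hypothesis (F1) («the class pressure has mean oscillation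
`O(‖v‖²_∞)` on balls», `…LargeScaleEnergy.exists_largeScale_energy_bound`, hypothesis `hBMO`).

The tree's local-pressure machinery (`Literature/Analysis/FluidPDE/LocalPressureOscillationSlab.lean`,
`slice_pressure_oscillation_le`; `LocalPressureSliceRepresentation.lean`, `slice_pressure_representation`)
turns the **slice pressure-gradient identities**

  `g(c) := ∫ [q(x) ∂ₑλ_δ(c − x) + D³Φ_δ(c − x)(e)(w x, w x)] dx = 0`   (all `δ = 1/(n+1)`, `c`, `e`)

(`Φ_δ = newtonReg δ` the regularised Newtonian kernel, `λ_δ = ΔΦ_δ` the unit-mass bump; this is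
Fernández-Dalgo–Lemarié-Rieusset's mollified form of `∇q = ∇Σℛᵢℛⱼ(wᵢwⱼ)`) into the Calderón–Zygmund /
far-field oscillation bound for `q` on every ball.  The tree proves these identities for *local Leray
solutions*, using the spatial decay of the velocity (`IsLocalLeraySolutionOn.ae_slice_pgIdentity`).  For the
Type-I ancient mild class there is no decay; instead the Oseen-mild identity (M) must kill the harmonic part.
This file isolates the decay-free half of that argument:

* `laplacian_normed_convolution_sliceFunctional_eq_zero` — for ANY measurable uniformly locally `L²` field
  `w` (with `|w|² ∈ L¹_loc`) and `q ∈ L¹_loc` satisfying the slice pressure Poisson equation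
  `∫ q Δθ = −∫ D²θ(w,w)` (all test `θ`), every mollification `ψ ⋆ g` of the functional `g` is **harmonic** —
  the slice version of the tree's `IsLocalLeraySolutionOn.laplacian_normed_convolution_pgFunctional_eq_zero`
  (same computation: the Laplacian is moved onto the profile, `ΔΦ_δ = λ_δ` makes every potential explicit,
  and the Poisson equation concludes);
* `sliceFunctional_eq_of_pressureTerm_bounded` — hence, with the Liouville lemma and the bounds of
  `…PressureGaugeTools`: **if the pressure part `c ↦ ∫ q ∂ₑλ_δ(c − ·)` is bounded, the functional is
  CONSTANT in `c`** — the mollified pressure gradient is the mollified Riesz-transform gradient plus a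
  constant vector (the «drift acceleration» `−c′(t)` of the negative lane's witnesses `c(t)e₃`, whose pressure
  `−c′(t)x₃` has exactly this affine gauge; for local Leray solutions the constant vanishes by decay, for the
  mild class by large-scale momentum conservation — sibling file `…LargeScaleMomentum`).

WHAT THIS IS NOT: not a claim about Navier–Stokes regularity and not the open residue S2⁗ — potential
theory of one time slice (bears_on LADDER-NS N0 via crux K2 = stmt-19708; whole-class tool).
-/

noncomputable section

-- the summit and its single sub-problem share the name (CONVENTIONS §1), as in every Theorems file
set_option linter.dupNamespace false
-- nested operator types `ℝ³ →L[ℝ] ℝ³ →L[ℝ] ℝ³ →L[ℝ] ℝ` (as in `LocalPressureLiouvilleKernel.lean`)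
set_option maxSynthPendingDepth 3

namespace Summit.NavierStokesRegularity.NavierStokesRegularity.Theorems.PoloidalWindowDoorPoloidalWindowRigidityPressureGauge

open MeasureTheory Set Function Filter Topology Metric InnerProductSpace
open scoped RealInnerProductSpace ENNReal NNReal Laplacian ContDiff Convolution
open Literature.Analysis Literature.Analysis.FluidPDE
open Summit.NavierStokesRegularity.NavierStokesRegularity.Theorems.PoloidalWindowDoorPoloidalWindowRigidityPressureGaugeTools

/-! ## Harmonicity of the mollified slice functional -/

section Harmonicity

variable {δ : ℝ} {w : EuclideanSpace ℝ (Fin 3) → EuclideanSpace ℝ (Fin 3)} {A : ℝ≥0∞}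
  {q : EuclideanSpace ℝ (Fin 3) → ℝ}

/-- **The mollifications of the slice functional are harmonic.** Let `w` be a measurable uniformly
locally `L²` field with `|w|² ∈ L¹_loc`, `q ∈ L¹_loc`, and assume the slice pressure Poisson equation
`∫ q Δθ = −∫ D²θ(w, w)` for every test function `θ`. Then for every bump `φ`, direction `e`, `δ > 0` and
point `b`, the mollification `ψ ⋆ g` (`ψ = φ.normed`) of
`g(c) = ∫ [q(x) ∂ₑλ_δ(c − x) + D³Φ_δ(c − x)(e)(w x, w x)] dx` has `Δ(ψ ⋆ g)(b) = 0`. The proof is the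
tree's space–time computation (`IsLocalLeraySolutionOn.laplacian_normed_convolution_pgFunctional_eq_zero`)
on one slice: `Δ(ψ ⋆ g)(b) = ∫ Δψ(s) g(b − s) ds`, Fubini, the Laplacian moved onto the profile
(`integral_laplacian_normed_mul_fderiv_laplacian_newtonReg`, `…_evalDiag_fderiv3_newtonReg`), and the
Poisson equation with the test function `θ = ∂ₑσ(b − ·)`, `σ = ψ ⋆ λ_δ`. -/
theorem laplacian_normed_convolution_sliceFunctional_eq_zero (hδ : 0 < δ)
    (hw : AEStronglyMeasurable w volume) (hAtop : A ≠ ⊤)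
    (hA : ∀ z : EuclideanSpace ℝ (Fin 3), ∫⁻ y in ball z 1, ‖w y‖ₑ ^ 2 ≤ A)
    (hw2 : LocallyIntegrable (fun x => ‖w x‖ ^ 2) volume) (hq : LocallyIntegrable q volume)
    (hP : ∀ θ : EuclideanSpace ℝ (Fin 3) → ℝ,
      FunctionSpaces.IsTestFunctionOn (⊤ : TopologicalSpace.Opens (EuclideanSpace ℝ (Fin 3))) θ →
        ∫ x, q x * Δ θ x = -∫ x, fderiv ℝ (fderiv ℝ θ) x (w x) (w x))
    (e : EuclideanSpace ℝ (Fin 3)) (φ : ContDiffBump (0 : EuclideanSpace ℝ (Fin 3)))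
    (b : EuclideanSpace ℝ (Fin 3)) :
    Δ (φ.normed volume ⋆[ContinuousLinearMap.lsmul ℝ ℝ, volume] fun c : EuclideanSpace ℝ (Fin 3) =>
      ∫ x, (q x * fderiv ℝ (Δ (newtonReg δ)) (c - x) e +
        evalDiag (w x) (fderiv ℝ (fderiv ℝ (fderiv ℝ (newtonReg δ))) (c - x) e))) b = 0 := by
  obtain ⟨M₀, M₁, M₂, -, hM₁0, -, -, hM₁, -⟩ := exists_bounds_laplacian_newtonReg hδ
  obtain ⟨C, hC0, hC⟩ := exists_norm_fderiv3_newtonReg_le_inv hδ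
  obtain ⟨Cw, hCwtop, hCw⟩ := exists_lintegral_mul_inv_one_add_norm_pow_le
  set ψ : EuclideanSpace ℝ (Fin 3) → ℝ := φ.normed volume with hψ
  set lam : EuclideanSpace ℝ (Fin 3) → ℝ := Δ (newtonReg δ) with hlam
  set K3 : EuclideanSpace ℝ (Fin 3) → EuclideanSpace ℝ (Fin 3) →L[ℝ]
      EuclideanSpace ℝ (Fin 3) →L[ℝ] EuclideanSpace ℝ (Fin 3) →L[ℝ] ℝ :=
    fderiv ℝ (fderiv ℝ (fderiv ℝ (newtonReg δ))) with hK3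
  set I : EuclideanSpace ℝ (Fin 3) → EuclideanSpace ℝ (Fin 3) → ℝ := fun x c =>
    q x * fderiv ℝ lam (c - x) e + evalDiag (w x) (K3 (c - x) e) with hI
  set F : EuclideanSpace ℝ (Fin 3) → ℝ := fun c => ∫ x, I x c with hF
  have hFc : Continuous F := continuous_sliceFunctional hδ hw hAtop hA hq e
  -- Step 1: the Laplacian falls on the bump
  rw [laplacian_convolution_lsmul φ.contDiff_normed φ.hasCompactSupport_normed hFc.locallyIntegrable b,
    convolution_lsmul_apply]
  -- Step 2: Fubini in `(s, x)`
  obtain ⟨Mψ, hMψ⟩ := (FluidPDE.continuous_laplacian (φ.contDiff_normed (μ := volume) (n := 2))).bounded_above_of_compact_support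
    ((φ.hasCompactSupport_normed (μ := volume)).mono' fun z hz => by
      contrapose! hz
      simp [FluidPDE.laplacian_eq_zero_of_notMem_tsupport hz])
  have hMψ0 : 0 ≤ Mψ := (norm_nonneg _).trans (hMψ 0)
  have hΔψ0 : ∀ s : EuclideanSpace ℝ (Fin 3), φ.rOut < ‖s‖ → Δ ψ s = 0 := by
    intro s hs
    refine FluidPDE.laplacian_eq_zero_of_notMem_tsupport ?_
    rw [hψ, φ.tsupport_normed_eq, mem_closedBall_zero_iff, not_le]
    exact hs
  set ρ : ℝ := φ.rOut with hρ
  have hρ0 : 0 < ρ := φ.rOut_pos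
  -- the compact ball carrying the pressure term
  set Kb : Set (EuclideanSpace ℝ (Fin 3)) := closedBall b (δ + ρ) with hKb
  have hKbc : IsCompact Kb := isCompact_closedBall _ _
  have hqKb : IntegrableOn q Kb volume := hq.integrableOn_isCompact hKbc
  have hballs : ∀ s ∈ closedBall (0 : EuclideanSpace ℝ (Fin 3)) ρ,
      closedBall (b - s) δ ⊆ closedBall b (δ + ρ) := by
    intro s hs y hy
    rw [mem_closedBall_zero_iff] at hs
    rw [mem_closedBall, dist_eq_norm] at hy ⊢
    calc ‖y - b‖ = ‖(y - (b - s)) - s‖ := by abel_nf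
      _ ≤ ‖y - (b - s)‖ + ‖s‖ := norm_sub_le _ _
      _ ≤ δ + ρ := add_le_add hy hs
  have hpress0 : ∀ s ∈ closedBall (0 : EuclideanSpace ℝ (Fin 3)) ρ, ∀ x, x ∉ Kb →
      q x * fderiv ℝ lam (b - s - x) e = 0 := by
    intro s hs x hx
    have h' : x ∉ closedBall (b - s) δ := fun h' => hx (hballs s hs h')
    rw [mem_closedBall, dist_eq_norm, not_le, ← norm_sub_rev] at h'
    rw [hlam, fderiv_laplacian_newtonReg_eq_zero hδ h', _root_.zero_apply, mul_zero]
  -- the dominating product function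
  set gz : EuclideanSpace ℝ (Fin 3) → ℝ := fun x =>
    Mψ * ((M₁ * ‖e‖) * ‖Kb.indicator q x‖ +
      (C * ‖e‖) * (1 + ρ) ^ 4 * (((1 + ‖x - b‖) ^ 4)⁻¹ * ‖w x‖ ^ 2)) with hgz
  obtain ⟨hwint, -⟩ := integrable_inv_one_add_norm_pow_mul_norm_sq hCwtop hCw hw hAtop hA b
  have hgzi : Integrable gz volume := by
    refine Integrable.const_mul (Integrable.add (Integrable.const_mul ?_ _) (hwint.const_mul _)) _
    exact (hqKb.integrable_indicator hKbc.measurableSet).norm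
  have hfs : Integrable (fun s : EuclideanSpace ℝ (Fin 3) => (closedBall (0 : EuclideanSpace ℝ (Fin 3)) ρ).indicator
      (fun _ => (1 : ℝ)) s) volume := by
    refine IntegrableOn.integrable_indicator ?_ measurableSet_closedBall
    exact (integrableOn_const_iff (by simp)).2 (Or.inr measure_closedBall_lt_top)
  have hdom : Integrable (fun p : EuclideanSpace ℝ (Fin 3) × EuclideanSpace ℝ (Fin 3) =>
      (closedBall (0 : EuclideanSpace ℝ (Fin 3)) ρ).indicator (fun _ => (1 : ℝ)) p.1 * gz p.2)
      ((volume : Measure (EuclideanSpace ℝ (Fin 3))).prod volume) := hfs.mul_prod hgzi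
  -- measurability of the integrand on the product
  have hl1 : ContDiff ℝ 1 lam := contDiff_laplacian_newtonReg hδ (n := 1)
  have hq2 : AEStronglyMeasurable (fun p : EuclideanSpace ℝ (Fin 3) × EuclideanSpace ℝ (Fin 3) => q p.2)
      ((volume : Measure (EuclideanSpace ℝ (Fin 3))).prod volume) :=
    hq.aestronglyMeasurable.comp_quasiMeasurePreserving Measure.quasiMeasurePreserving_snd
  have hw2' : AEStronglyMeasurable (fun p : EuclideanSpace ℝ (Fin 3) × EuclideanSpace ℝ (Fin 3) => w p.2)
      ((volume : Measure (EuclideanSpace ℝ (Fin 3))).prod volume) :=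
    hw.comp_quasiMeasurePreserving Measure.quasiMeasurePreserving_snd
  have hmeas : AEStronglyMeasurable (uncurry fun (s : EuclideanSpace ℝ (Fin 3))
      (x : EuclideanSpace ℝ (Fin 3)) => Δ ψ s * I x (b - s))
      ((volume : Measure (EuclideanSpace ℝ (Fin 3))).prod volume) := by
    have hc1 : Continuous fun p : EuclideanSpace ℝ (Fin 3) × EuclideanSpace ℝ (Fin 3) => Δ ψ p.1 :=
      (FluidPDE.continuous_laplacian (φ.contDiff_normed (μ := volume) (n := 2))).comp continuous_fst
    have hc3 : Continuous fun p : EuclideanSpace ℝ (Fin 3) × EuclideanSpace ℝ (Fin 3) =>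
        fderiv ℝ lam (b - p.1 - p.2) e :=
      ((hl1.continuous_fderiv one_ne_zero).comp ((continuous_const.sub continuous_fst).sub
        continuous_snd)).clm_apply continuous_const
    have hc4 : Continuous fun p : EuclideanSpace ℝ (Fin 3) × EuclideanSpace ℝ (Fin 3) =>
        K3 (b - p.1 - p.2) e :=
      ((continuous_fderiv3_newtonReg δ).comp ((continuous_const.sub continuous_fst).sub
        continuous_snd)).clm_apply continuous_const
    have h5 : AEStronglyMeasurable (fun p : EuclideanSpace ℝ (Fin 3) × EuclideanSpace ℝ (Fin 3) =>
        evalDiag (w p.2) (K3 (b - p.1 - p.2) e)) ((volume : Measure (EuclideanSpace ℝ (Fin 3))).prod volume) :=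
      aestronglyMeasurable_evalDiag_apply' hw2' hc4.aestronglyMeasurable
    exact hc1.aestronglyMeasurable.mul ((hq2.mul hc3.aestronglyMeasurable).add h5)
  have hprodInt : Integrable (uncurry fun (s : EuclideanSpace ℝ (Fin 3))
      (x : EuclideanSpace ℝ (Fin 3)) => Δ ψ s * I x (b - s))
      ((volume : Measure (EuclideanSpace ℝ (Fin 3))).prod volume) := by
    refine Integrable.mono' hdom hmeas (Eventually.of_forall fun p => ?_)
    rcases p with ⟨s, x⟩
    simp only [uncurry]
    by_cases hs : s ∈ closedBall (0 : EuclideanSpace ℝ (Fin 3)) ρ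
    · rw [indicator_of_mem hs, one_mul, norm_mul, hgz]
      refine mul_le_mul (hMψ s) ?_ (norm_nonneg _) hMψ0
      rw [hI]
      dsimp only
      refine (norm_add_le _ _).trans (add_le_add ?_ ?_)
      · -- pressure part
        by_cases hx : x ∈ Kb
        · rw [indicator_of_mem hx, norm_mul]
          calc ‖q x‖ * ‖fderiv ℝ lam (b - s - x) e‖ ≤ ‖q x‖ * (M₁ * ‖e‖) := by
                refine mul_le_mul_of_nonneg_left ?_ (norm_nonneg _)
                exact (ContinuousLinearMap.le_opNorm _ _).trans
                  (mul_le_mul_of_nonneg_right (hM₁ _) (norm_nonneg _))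
            _ = M₁ * ‖e‖ * ‖q x‖ := by ring
        · rw [hpress0 s hs x hx, norm_zero, indicator_of_notMem hx, norm_zero, mul_zero]
      · -- velocity part
        have hsn : ‖s‖ ≤ ρ := mem_closedBall_zero_iff.1 hs
        have hcmp : ((1 + ‖b - s - x‖) ^ 4)⁻¹ ≤ (1 + ρ) ^ 4 * ((1 + ‖x - b‖) ^ 4)⁻¹ := by
          have h1 : ((1 + ‖b - s - x‖) ^ 4)⁻¹ ≤ (1 + ‖s‖) ^ 4 * ((1 + ‖x - b‖) ^ 4)⁻¹ := by
            refine inv_one_add_pow_le_mul (norm_nonneg _) (norm_nonneg _) ?_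
            have : ‖x - b‖ ≤ ‖b - s - x‖ + ‖s‖ := by
              calc ‖x - b‖ = ‖(b - s - x) + s‖ := by
                    rw [← norm_neg (x - b)]; congr 1; abel
                _ ≤ ‖b - s - x‖ + ‖s‖ := norm_add_le _ _
            nlinarith [norm_nonneg (b - s - x), norm_nonneg s]
          refine h1.trans (mul_le_mul_of_nonneg_right ?_ (by positivity))
          exact pow_le_pow_left₀ (by positivity) (by linarith) 4
        calc ‖evalDiag (w x) (K3 (b - s - x) e)‖
            ≤ ‖evalDiag (w x)‖ * ‖K3 (b - s - x) e‖ := ContinuousLinearMap.le_opNorm _ _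
          _ ≤ ‖w x‖ ^ 2 * (C * ((1 + ρ) ^ 4 * ((1 + ‖x - b‖) ^ 4)⁻¹) * ‖e‖) := by
              refine mul_le_mul (norm_evalDiag_le _) ?_ (norm_nonneg _) (by positivity)
              refine (ContinuousLinearMap.le_opNorm _ _).trans (mul_le_mul_of_nonneg_right ?_ (norm_nonneg _))
              exact (hC _).trans (mul_le_mul_of_nonneg_left hcmp hC0)
          _ = C * ‖e‖ * (1 + ρ) ^ 4 * (((1 + ‖x - b‖) ^ 4)⁻¹ * ‖w x‖ ^ 2) := by ring
    · have hs' : ρ < ‖s‖ := by rwa [mem_closedBall_zero_iff, not_le] at hs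
      rw [hΔψ0 s hs', zero_mul, norm_zero, indicator_of_notMem hs, zero_mul]
  have hswap : ∫ s, Δ ψ s * F (b - s) = ∫ x, (∫ s, Δ ψ s * I x (b - s)) := by
    have h1 : ∀ s, Δ ψ s * F (b - s) = ∫ x, Δ ψ s * I x (b - s) := fun s => by
      rw [hF]
      exact (integral_const_mul _ _).symm
    simp_rw [h1]
    exact integral_integral_swap hprodInt
  rw [hswap]
  -- Step 3: the inner integral, pointwise in `x`
  set σ : EuclideanSpace ℝ (Fin 3) → ℝ := fun w' => ∫ s, ψ s * lam (w' - s) with hσ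
  set θ : EuclideanSpace ℝ (Fin 3) → ℝ := fun y => fderiv ℝ σ (b - y) e with hθ
  have hθtest : FunctionSpaces.IsTestFunctionOn (⊤ : TopologicalSpace.Opens (EuclideanSpace ℝ (Fin 3))) θ :=
    isTestFunctionOn_fderiv_mollifiedProfile φ hδ b e
  have hinner : ∀ x : EuclideanSpace ℝ (Fin 3), ∫ s, Δ ψ s * I x (b - s) =
      q x * Δ θ x + fderiv ℝ (fderiv ℝ θ) x (w x) (w x) := by
    intro x
    obtain ⟨hΔθ, hD2θ⟩ := laplacian_and_fderiv2_test φ hδ b x (w x) e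
    have hA' : ∫ s, Δ ψ s * fderiv ℝ lam (b - s - x) e = Δ θ x := by
      rw [hθ, hΔθ]
      exact integral_laplacian_normed_mul_fderiv_laplacian_newtonReg φ hδ b x e
    have hB' : ∫ s, Δ ψ s * evalDiag (w x) (K3 (b - s - x) e) =
        fderiv ℝ (fderiv ℝ θ) x (w x) (w x) := by
      rw [hθ, hD2θ]
      exact integral_laplacian_normed_mul_evalDiag_fderiv3_newtonReg φ hδ b x e (w x)
    have hΔψc : Continuous (Δ ψ) := FluidPDE.continuous_laplacian (φ.contDiff_normed (μ := volume) (n := 2))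
    have hΔψs : HasCompactSupport (Δ ψ) := (φ.hasCompactSupport_normed (μ := volume)).mono' fun z hz => by
      contrapose! hz
      rw [Function.mem_support, not_not]
      exact FluidPDE.laplacian_eq_zero_of_notMem_tsupport hz
    have hiA : Integrable fun s => Δ ψ s * fderiv ℝ lam (b - s - x) e :=
      (hΔψc.mul (((hl1.continuous_fderiv one_ne_zero).comp ((continuous_const.sub continuous_id).sub
        continuous_const)).clm_apply continuous_const)).integrable_of_hasCompactSupport hΔψs.mul_right
    have hiB : Integrable fun s => Δ ψ s * evalDiag (w x) (K3 (b - s - x) e) :=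
      (hΔψc.mul ((evalDiag (w x)).continuous.comp (((continuous_fderiv3_newtonReg δ).comp
        ((continuous_const.sub continuous_id).sub continuous_const)).clm_apply
          continuous_const))).integrable_of_hasCompactSupport hΔψs.mul_right
    have hsplit : ∀ s, Δ ψ s * I x (b - s) = q x * (Δ ψ s * fderiv ℝ lam (b - s - x) e) +
        Δ ψ s * evalDiag (w x) (K3 (b - s - x) e) := fun s => by
      rw [hI]
      ring
    simp_rw [hsplit]
    rw [integral_add (hiA.const_mul _) hiB, integral_const_mul, hA', hB']
  simp_rw [hinner]
  -- Step 4: the pressure Poisson equation on the slice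
  have hid := hP θ hθtest
  have hθc2 : ContDiff ℝ 2 θ := contDiff_infty.1 hθtest.contDiff 2
  have hΔθc : Continuous (Δ θ) := FluidPDE.continuous_laplacian hθc2
  have hD2θc : Continuous (fderiv ℝ (fderiv ℝ θ)) :=
    (hθc2.fderiv_right (m := 1) le_rfl).continuous_fderiv one_ne_zero
  have hΔθs : HasCompactSupport (Δ θ) := hθtest.hasCompactSupport.mono' fun z hz => by
    contrapose! hz
    simp [FluidPDE.laplacian_eq_zero_of_notMem_tsupport hz]
  have hD2θs : HasCompactSupport (fderiv ℝ (fderiv ℝ θ)) :=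
    (hθtest.hasCompactSupport.fderiv (𝕜 := ℝ)).fderiv (𝕜 := ℝ)
  have hi1 : Integrable (fun x => q x * Δ θ x) volume := by
    have h := hq.integrable_smul_right_of_hasCompactSupport hΔθc hΔθs
    simpa only [smul_eq_mul] using h
  have hi2 : Integrable (fun x => fderiv ℝ (fderiv ℝ θ) x (w x) (w x)) volume := by
    obtain ⟨M, hM⟩ := hD2θc.bounded_above_of_compact_support hD2θs
    have hdom' : Integrable (fun x => M * (tsupport θ).indicator (fun x => ‖w x‖ ^ 2) x) volume :=
      ((hw2.integrableOn_isCompact hθtest.hasCompactSupport).integrable_indicator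
        (hθtest.hasCompactSupport.measurableSet)).const_mul _
    refine Integrable.mono' hdom' ?_ (Eventually.of_forall fun x => ?_)
    · have := aestronglyMeasurable_evalDiag_apply hw hD2θc.aestronglyMeasurable
      simpa only [evalDiag_apply] using this
    · by_cases hx : x ∈ tsupport θ
      · rw [indicator_of_mem hx]
        calc ‖fderiv ℝ (fderiv ℝ θ) x (w x) (w x)‖
            ≤ ‖fderiv ℝ (fderiv ℝ θ) x (w x)‖ * ‖w x‖ := ContinuousLinearMap.le_opNorm _ _
          _ ≤ ‖fderiv ℝ (fderiv ℝ θ) x‖ * ‖w x‖ * ‖w x‖ :=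
              mul_le_mul_of_nonneg_right (ContinuousLinearMap.le_opNorm _ _) (norm_nonneg _)
          _ ≤ M * ‖w x‖ * ‖w x‖ := by gcongr; exact hM x
          _ = M * ‖w x‖ ^ 2 := by ring
      · rw [fderiv_fderiv_eq_zero_of_notMem_tsupport hx, indicator_of_notMem hx]
        simp
  rw [integral_add hi1 hi2, hid]
  ring

/-- **The slice functional is constant when its pressure part is bounded.** Under the hypotheses of
`laplacian_normed_convolution_sliceFunctional_eq_zero`, if moreover `c ↦ ∫ q(x) ∂ₑλ_δ(c − x) dx` is bounded
on `ℝ³`, then `g(c) = ∫ [q(x) ∂ₑλ_δ(c − x) + D³Φ_δ(c − x)(e)(w x, w x)] dx` does not depend on `c`: the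
mollified pressure gradient is the mollified Riesz-transform gradient **plus a constant vector** (the affine
gauge of the pressure; for local Leray solutions the constant vanishes by decay, for the mild class by the
sibling file's momentum argument). [folklore] -/
theorem sliceFunctional_eq_of_pressureTerm_bounded (hδ : 0 < δ)
    (hw : AEStronglyMeasurable w volume) (hAtop : A ≠ ⊤)
    (hA : ∀ z : EuclideanSpace ℝ (Fin 3), ∫⁻ y in ball z 1, ‖w y‖ₑ ^ 2 ≤ A)
    (hw2 : LocallyIntegrable (fun x => ‖w x‖ ^ 2) volume) (hq : LocallyIntegrable q volume)
    (hP : ∀ θ : EuclideanSpace ℝ (Fin 3) → ℝ,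
      FunctionSpaces.IsTestFunctionOn (⊤ : TopologicalSpace.Opens (EuclideanSpace ℝ (Fin 3))) θ →
        ∫ x, q x * Δ θ x = -∫ x, fderiv ℝ (fderiv ℝ θ) x (w x) (w x))
    (e : EuclideanSpace ℝ (Fin 3))
    (hbdd : ∃ B : ℝ, ∀ c : EuclideanSpace ℝ (Fin 3), |∫ x, q x * fderiv ℝ (Δ (newtonReg δ)) (c - x) e| ≤ B)
    (c c' : EuclideanSpace ℝ (Fin 3)) :
    ∫ x, (q x * fderiv ℝ (Δ (newtonReg δ)) (c - x) e +
        evalDiag (w x) (fderiv ℝ (fderiv ℝ (fderiv ℝ (newtonReg δ))) (c - x) e)) =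
      ∫ x, (q x * fderiv ℝ (Δ (newtonReg δ)) (c' - x) e +
        evalDiag (w x) (fderiv ℝ (fderiv ℝ (fderiv ℝ (newtonReg δ))) (c' - x) e)) := by
  obtain ⟨B, hB⟩ := hbdd
  obtain ⟨K, hK⟩ := abs_velocityTerm_le hδ hw hAtop hA e
  refine eq_of_bounded_of_laplacian_normed_convolution_eq_zero
    (continuous_sliceFunctional hδ hw hAtop hA hq e) ⟨B + K, fun c₀ => ?_⟩
    (fun φ b₀ => laplacian_normed_convolution_sliceFunctional_eq_zero hδ hw hAtop hA hw2 hq hP e φ b₀) c c'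
  have hi1 : Integrable (fun x => q x * fderiv ℝ (Δ (newtonReg δ)) (c₀ - x) e) volume :=
    integrable_pressureTerm hδ hq c₀ e
  have hi2 := integrable_evalDiag_fderiv3_newtonReg hδ hw hAtop hA c₀ e
  rw [integral_add hi1 hi2]
  exact (abs_add_le _ _).trans (add_le_add (hB c₀) (hK c₀))

end Harmonicity

end Summit.NavierStokesRegularity.NavierStokesRegularity.Theorems.PoloidalWindowDoorPoloidalWindowRigidityPressureGauge

end
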